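import Literature.Probability.Percolation.HierarchicalNoRunaway
import Literature.Probability.Percolation.HierarchicalTwoPointRecursion
import HarnessLib

/-!
# Hierarchical long-range percolation: an excellent block (Hutchcroft 2022, Lemma 2.11)

Topic `Literature/Probability/Percolation`. Theorem-only sequel of `HierarchicalNoRunaway.lean`
(`IsGoodUpTo`) and `HierarchicalTwoPointRecursion.lean` (`Tblock`), toward the named fact
`Hutchcroft2022_twoPoint_volumeTail`:

* `card_eq_card_image_block_mul`, `sum_eq_sum_image_block` — a block-saturated finite set is the
  disjoint union of its `m`-blocks;
* `card_filter_isGoodUpTo_succ_le` — the points good from level `m` are at least half of those good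
  from level `m+1` (Lemma 2.1 in bulk);
* **`exists_excellent_block`** — Lemma 2.11 in finite-height form: given a bound
  `Σ_{x,y∈B_m(x)} P(x ↔ y in η_{B_m(x)}) ≤ Φ(m)` for blocks good from level `m` up to `N` (Prop. 2.7),
  below every such `(n+ℓ)`-block there is an `n`-block `B_n`, good from level `n`, with
  `𝐓_k(B_n) ≤ 4^k L^{-dk} Φ(n+k)` for all `0 ≤ k ≤ ℓ`.

## References

* [Hutchcroft2022] T. Hutchcroft, J. Math. Phys. 63 (2022), arXiv:2202.07634, Lemma 2.11 and its
  proof (pp. 12–13), Lemma 2.1.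
-/

noncomputable section

namespace Literature.Probability.Percolation

open Finset MeasureTheory Literature.Probability.LatticeModels

variable {d : ℕ}

/-! ### Block-saturated sets and the doubling of good points -/

section Excellent

variable {L : ℕ} {o : ℕ → Site d} {J : Sym2 (Site d) → ℝ} {c α β : ℝ}

/-- Blocks of a point of `B_m(z)` above level `m` are those of `z`. [folklore] -/
theorem block_eq_block_of_mem_of_le (hL1 : 1 ≤ L) (ho : IsHierOffset L o) {m m' : ℕ} {x z : Site d}
    (hx : x ∈ block L o m z) (hmm' : m ≤ m') : block L o m' x = block L o m' z :=
  (block_eq_iff_mem hL1 o).2 (block_mono hL1 o ho hmm' z hx)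

/-- Goodness up to level `N` from level `m` only depends on the `m`-block. [folklore] -/
theorem isGoodUpTo_iff_of_mem_block (hL1 : 1 ≤ L) (ho : IsHierOffset L o) {m N : ℕ} {x x' : Site d}
    (hx' : x' ∈ block L o m x) : IsGoodUpTo J L o c α β m N x' ↔ IsGoodUpTo J L o c α β m N x := by
  unfold IsGoodUpTo
  refine forall_congr' fun k => forall_congr' fun hk => forall_congr' fun _ => ?_
  rw [block_eq_block_of_mem_of_le hL1 ho hx' hk]
  exact isGood_iff_of_mem_block hL1 (block_mono hL1 o ho (Nat.le_succ_of_le hk) x hx') _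

/-- **A block-saturated finite set is the disjoint union of its `m`-blocks**: cardinality.
[folklore] -/
theorem card_eq_card_image_block_mul (hL1 : 1 ≤ L) {m : ℕ} {G : Finset (Site d)}
    (hG : ∀ x ∈ G, block L o m x ⊆ G) :
    G.card = (G.image (block L o m)).card * (L ^ m) ^ d := by
  classical
  have hcover : G = (G.image (block L o m)).biUnion id := by
    ext y
    simp only [Finset.mem_biUnion, Finset.mem_image, id, exists_exists_and_eq_and]
    constructor
    · intro hy; exact ⟨y, hy, mem_block_self hL1 o m y⟩
    · rintro ⟨x, hx, hy⟩; exact hG x hx hy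
  have hdisj : (↑(G.image (block L o m)) : Set (Finset (Site d))).PairwiseDisjoint id := by
    intro B hB B' hB' hne
    obtain ⟨x, -, rfl⟩ := Finset.mem_image.1 hB
    obtain ⟨x', -, rfl⟩ := Finset.mem_image.1 hB'
    rcases block_eq_or_disjoint hL1 o m x x' with h | h
    · exact absurd h hne
    · exact h
  conv_lhs => rw [hcover]
  rw [Finset.card_biUnion hdisj, Finset.sum_const_nat (m := (L ^ m) ^ d)]
  intro B hB
  obtain ⟨x, -, rfl⟩ := Finset.mem_image.1 hB
  exact card_block o m x

/-- **A block-saturated finite set is the disjoint union of its `m`-blocks**: sums. [folklore] -/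
theorem sum_eq_sum_image_block (hL1 : 1 ≤ L) {m : ℕ} {G : Finset (Site d)}
    (hG : ∀ x ∈ G, block L o m x ⊆ G) (f : Site d → ℝ) :
    ∑ x ∈ G, f x = ∑ B ∈ G.image (block L o m), ∑ x ∈ B, f x := by
  classical
  have hcover : G = (G.image (block L o m)).biUnion id := by
    ext y
    simp only [Finset.mem_biUnion, Finset.mem_image, id, exists_exists_and_eq_and]
    constructor
    · intro hy; exact ⟨y, hy, mem_block_self hL1 o m y⟩
    · rintro ⟨x, hx, hy⟩; exact hG x hx hy
  have hdisj : (↑(G.image (block L o m)) : Set (Finset (Site d))).PairwiseDisjoint id := by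
    intro B hB B' hB' hne
    obtain ⟨x, -, rfl⟩ := Finset.mem_image.1 hB
    obtain ⟨x', -, rfl⟩ := Finset.mem_image.1 hB'
    rcases block_eq_or_disjoint hL1 o m x x' with h | h
    · exact absurd h hne
    · exact h
  conv_lhs => rw [hcover]
  rw [Finset.sum_biUnion hdisj]
  rfl

/-- **Deterministic Markov inequality** for a nonnegative function on a finite set. [folklore] -/
theorem card_filter_lt_mul_le_sum {κ : Type*} (S : Finset κ) (T : κ → ℝ) (hT : ∀ B ∈ S, 0 ≤ T B) (b : ℝ) :
    b * ((S.filter fun B => b < T B).card : ℝ) ≤ ∑ B ∈ S, T B := by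
  classical
  calc b * ((S.filter fun B => b < T B).card : ℝ) = ∑ _B ∈ S.filter (fun B => b < T B), b := by
        rw [Finset.sum_const, nsmul_eq_mul, mul_comm]
    _ ≤ ∑ B ∈ S.filter (fun B => b < T B), T B :=
        Finset.sum_le_sum fun B hB => (Finset.mem_filter.1 hB).2.le
    _ ≤ ∑ B ∈ S, T B :=
        Finset.sum_le_sum_of_subset_of_nonneg (Finset.filter_subset _ _) fun B hB _ => hT B hB

variable (hL : 2 ≤ L) (hd : 1 ≤ d) (ho : IsHierOffset L o)
include hL hd ho

open Classical in
/-- **Good points double at each level down** (Lemma 2.1 in bulk): inside an `(m+1)`-saturated set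
`P`, the points whose blocks are good from level `m` up to `N` are at least half as many as those
good from level `m+1` ("every block in `𝒜_k` is an ancestor of at least `2^{-k}L^{dk}` blocks in
`𝓑_0`"). [cite: Hutchcroft2022, proof of Lemma 2.11 (p. 13)] -/
theorem card_filter_isGoodUpTo_succ_le {m N : ℕ} {P : Finset (Site d)}
    (hP : ∀ x ∈ P, block L o (m + 1) x ⊆ P) :
    (P.filter fun x => IsGoodUpTo J L o c α β (m + 1) N x).card ≤
      2 * (P.filter fun x => IsGoodUpTo J L o c α β m N x).card := by
  classical
  have hL1 : 1 ≤ L := le_trans (by norm_num) hL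
  set G₁ := P.filter fun x => IsGoodUpTo J L o c α β (m + 1) N x with hG₁
  set G₀ := P.filter fun x => IsGoodUpTo J L o c α β m N x with hG₀
  -- `G₁` is `(m+1)`-saturated
  have hsat : ∀ x ∈ G₁, block L o (m + 1) x ⊆ G₁ := by
    intro x hx y hy
    obtain ⟨hxP, hxg⟩ := Finset.mem_filter.1 hx
    exact Finset.mem_filter.2 ⟨hP x hxP hy, (isGoodUpTo_iff_of_mem_block hL1 ho hy).2 hxg⟩
  set 𝒜 := G₁.image (block L o (m + 1)) with h𝒜
  have hcard₁ : G₁.card = 𝒜.card * (L ^ (m + 1)) ^ d := card_eq_card_image_block_mul hL1 hsat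
  -- inside each block of `𝒜`, the good children lie in `G₀`
  set U : Finset (Site d) → Finset (Site d) := fun B' =>
    (B'.image (block L o m)).filter (fun C => C ⊆ G₀) |>.biUnion id with hU
  have hUsub : ∀ B' ∈ 𝒜, U B' ⊆ G₀ ∩ B' := by
    intro B' hB' y hy
    simp only [hU, Finset.mem_biUnion, Finset.mem_filter, Finset.mem_image, id] at hy
    obtain ⟨C, ⟨⟨x', hx', rfl⟩, hCG⟩, hyC⟩ := hy
    refine Finset.mem_inter.2 ⟨hCG hyC, ?_⟩
    obtain ⟨x, -, rfl⟩ := Finset.mem_image.1 hB'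
    have h := block_subset_block_succ hL1 o ho m x' hyC
    rwa [(block_eq_iff_mem hL1 o).2 hx'] at h
  -- counting the good children of a block of `𝒜`
  have hUcard : ∀ B' ∈ 𝒜, (L ^ d - L ^ d / 2) * (L ^ m) ^ d ≤ (U B').card := by
    intro B' hB'
    obtain ⟨x, hx, rfl⟩ := Finset.mem_image.1 hB'
    obtain ⟨-, hxg⟩ := Finset.mem_filter.1 hx
    -- the good children are among the `C ⊆ G₀`
    have hgood : ((children L o m x).filter fun C => IsGood J L o c α β m x C) ⊆
        ((block L o (m + 1) x).image (block L o m)).filter fun C => C ⊆ G₀ := by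
      intro C hC
      obtain ⟨hCc, hCg⟩ := Finset.mem_filter.1 hC
      refine Finset.mem_filter.2 ⟨hCc, fun y hy => ?_⟩
      obtain ⟨y', hy', rfl⟩ := (mem_children_iff o).1 hCc
      have hyP : y ∈ block L o (m + 1) x := (subset_of_mem_children hL1 o ho hCc) hy
      refine Finset.mem_filter.2 ⟨hP x (Finset.mem_filter.1 hx).1 hyP, ?_⟩
      intro k hk hkN
      rcases (show k = m ∨ m + 1 ≤ k by omega) with rfl | hk'
      · rw [(block_eq_iff_mem hL1 o).2 hy]
        exact (isGood_iff_of_mem_block hL1 hyP _).2 hCg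
      · have := (isGoodUpTo_iff_of_mem_block hL1 ho hyP (J := J) (c := c) (α := α) (β := β) (N := N)).2 hxg
        exact this k hk' hkN
    have hdisjC : (↑(((block L o (m + 1) x).image (block L o m)).filter fun C => C ⊆ G₀) :
        Set (Finset (Site d))).PairwiseDisjoint id := by
      intro C hC C' hC' hne
      obtain ⟨y, -, rfl⟩ := Finset.mem_image.1 (Finset.mem_filter.1 hC).1
      obtain ⟨y', -, rfl⟩ := Finset.mem_image.1 (Finset.mem_filter.1 hC').1
      rcases block_eq_or_disjoint hL1 o m y y' with h | h
      · exact absurd h hne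
      · exact h
    simp only [hU]
    rw [Finset.card_biUnion hdisjC]
    calc (L ^ d - L ^ d / 2) * (L ^ m) ^ d
        ≤ ((children L o m x).filter fun C => IsGood J L o c α β m x C).card * (L ^ m) ^ d :=
          Nat.mul_le_mul_right _ (card_good_children_ge hL hd ho J c α β m x)
      _ = ∑ C ∈ (children L o m x).filter (fun C => IsGood J L o c α β m x C), (id C).card := by
          rw [Finset.sum_const_nat fun C hC => ?_]
          obtain ⟨y, -, rfl⟩ := (mem_children_iff o).1 (Finset.mem_filter.1 hC).1
          exact card_block o m y
      _ ≤ ∑ C ∈ ((block L o (m + 1) x).image (block L o m)).filter (fun C => C ⊆ G₀), (id C).card :=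
          Finset.sum_le_sum_of_subset_of_nonneg hgood fun _ _ _ => Nat.zero_le _
  -- the `U B'` are disjoint pieces of `G₀`
  have hdisjU : (↑𝒜 : Set (Finset (Site d))).PairwiseDisjoint U := by
    intro B hB B' hB' hne
    have hBB' : Disjoint B B' := by
      obtain ⟨x, -, rfl⟩ := Finset.mem_image.1 hB
      obtain ⟨x', -, rfl⟩ := Finset.mem_image.1 hB'
      rcases block_eq_or_disjoint hL1 o (m + 1) x x' with h | h
      · exact absurd h hne
      · exact h
    exact hBB'.mono ((hUsub B hB).trans Finset.inter_subset_right)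
      ((hUsub B' hB').trans Finset.inter_subset_right)
  have hG₀ : 𝒜.card * ((L ^ d - L ^ d / 2) * (L ^ m) ^ d) ≤ G₀.card := by
    calc 𝒜.card * ((L ^ d - L ^ d / 2) * (L ^ m) ^ d) = ∑ _B' ∈ 𝒜, (L ^ d - L ^ d / 2) * (L ^ m) ^ d := by
          rw [Finset.sum_const, smul_eq_mul]
      _ ≤ ∑ B' ∈ 𝒜, (U B').card := Finset.sum_le_sum hUcard
      _ = (𝒜.biUnion U).card := (Finset.card_biUnion hdisjU).symm
      _ ≤ G₀.card := Finset.card_le_card (Finset.biUnion_subset.2 fun B' hB' =>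
          (hUsub B' hB').trans Finset.inter_subset_left)
  -- arithmetic: `2 (L^d - ⌊L^d/2⌋) ≥ L^d`
  rw [hcard₁]
  have h2 : (L ^ (m + 1)) ^ d = L ^ d * (L ^ m) ^ d := by
    rw [pow_succ, mul_pow, mul_comm]
  rw [h2]
  have key : L ^ d ≤ 2 * (L ^ d - L ^ d / 2) := by omega
  calc 𝒜.card * (L ^ d * (L ^ m) ^ d) ≤ 𝒜.card * (2 * (L ^ d - L ^ d / 2) * (L ^ m) ^ d) :=
        Nat.mul_le_mul_left _ (Nat.mul_le_mul_right _ key)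
    _ = 2 * (𝒜.card * ((L ^ d - L ^ d / 2) * (L ^ m) ^ d)) := by ring
    _ ≤ 2 * G₀.card := Nat.mul_le_mul_left 2 hG₀

end Excellent

section ExcellentMain

variable {L : ℕ} (hL : 2 ≤ L) (hd : 1 ≤ d) {o : ℕ → Site d} (ho : IsHierOffset L o)
  {J : Sym2 (Site d) → ℝ} {c α β : ℝ}

/-- `Σ_{k=1}^{ℓ} 2^{-k} = 1 - 2^{-ℓ}`. [folklore] -/
theorem sum_Icc_half_pow (ℓ : ℕ) : ∑ k ∈ Finset.Icc 1 ℓ, (1 / 2 : ℝ) ^ k = 1 - (1 / 2) ^ ℓ := by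
  induction ℓ with
  | zero => simp
  | succ ℓ ih => rw [Finset.sum_Icc_succ_top (by omega), ih]; ring

include hL hd ho in
open Classical in
/-- **Lemma 2.11 (an excellent block)**, finite-height form. Suppose `Σ_{x,y∈B_m(x)} P(x ↔ y in η_{B_m(x)}) ≤ Φ(m)`
whenever `B_k(x)` is a good child of `B_{k+1}(x)` for `m ≤ k < N` (Prop. 2.7 provides
`Φ(m) = (A/(cβ))L^{(d+α)m}` for `N ≥ N₀`). If `B_{n+ℓ}(z)` is such a block (from level `n+ℓ`), then some
`n`-block `B_n(x) ⊆ B_{n+ℓ}(z)`, good from level `n` up to `N`, satisfies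
`𝐓_k(B_n(x)) ≤ 4^k L^{-dk} Φ(n+k)` for all `0 ≤ k ≤ ℓ` (with Prop. 2.7: `≤ (A/(cβ)) 4^k L^{(d+α)n+αk}`).
Proof as printed: the good points halve at most at each level down (`|G_0| ≥ 2^{-k}|G_k|`),
`Σ_{x∈G_k} 𝐭_k(x) = Σ_{B'∈𝒜_k} 𝐓_0(B') ≤ |𝒜_k| Φ(n+k)`, and Markov's inequality over the
`n`-blocks of `G_0` for each `1 ≤ k ≤ ℓ` (`Σ_k 2^{-k} < 1`). [cite: Hutchcroft2022, Lemma 2.11 and its proof (pp. 12–13)] -/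
theorem exists_excellent_block {N : ℕ} {Φ : ℕ → ℝ} (hΦ0 : ∀ m, 0 ≤ Φ m)
    (hΦ : ∀ (m : ℕ) (x : Site d), IsGoodUpTo J L o c α β m N x →
      sumConn J L o c α β (block L o m x) ≤ Φ m)
    (n ℓ : ℕ) (z : Site d) (hz : IsGoodUpTo J L o c α β (n + ℓ) N z) :
    ∃ x ∈ block L o (n + ℓ) z, IsGoodUpTo J L o c α β n N x ∧
      ∀ k, k ≤ ℓ → Tblock J L o c α β n (n + k) x ≤ 4 ^ k * ((L : ℝ) ^ (d * k))⁻¹ * Φ (n + k) := by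
  classical
  have hL1 : 1 ≤ L := le_trans (by norm_num) hL
  have hℓ0 : (0 : ℝ) < L := by exact_mod_cast (by omega : 0 < L)
  set P := block L o (n + ℓ) z with hP
  set G : ℕ → Finset (Site d) := fun k => P.filter fun x => IsGoodUpTo J L o c α β (n + k) N x with hG
  -- saturation
  have hPsat : ∀ k, k ≤ ℓ → ∀ x ∈ P, block L o (n + k) x ⊆ P := by
    intro k hk x hx
    have h1 : block L o (n + ℓ) x = P := block_eq_block_of_mem_of_le hL1 ho hx le_rfl
    rw [← h1]
    exact block_mono hL1 o ho (by omega) x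
  have hGsat : ∀ k, k ≤ ℓ → ∀ x ∈ G k, block L o (n + k) x ⊆ G k := by
    intro k hk x hx y hy
    obtain ⟨hxP, hxg⟩ := Finset.mem_filter.1 hx
    exact Finset.mem_filter.2 ⟨hPsat k hk x hxP hy, (isGoodUpTo_iff_of_mem_block hL1 ho hy).2 hxg⟩
  have hGℓ : G ℓ = P := by
    refine Finset.filter_true_of_mem fun x hx => ?_
    exact (isGoodUpTo_iff_of_mem_block hL1 ho hx).2 hz
  have hG0k : ∀ k, G 0 ⊆ G k := fun k x hx =>
    Finset.mem_filter.2 ⟨(Finset.mem_filter.1 hx).1, (Finset.mem_filter.1 hx).2.mono (by omega) le_rfl⟩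
  -- doubling
  have hdouble : ∀ k, k < ℓ → (G (k + 1)).card ≤ 2 * (G k).card := by
    intro k hk
    have := card_filter_isGoodUpTo_succ_le hL hd ho (J := J) (c := c) (α := α) (β := β)
      (m := n + k) (N := N) (P := P) (hPsat (k + 1) hk)
    exact this
  have hpow : ∀ k, k ≤ ℓ → (G k).card ≤ 2 ^ k * (G 0).card := by
    intro k
    induction k with
    | zero => intro _; simp
    | succ k ih =>
      intro hk
      calc (G (k + 1)).card ≤ 2 * (G k).card := hdouble k (by omega)
        _ ≤ 2 * (2 ^ k * (G 0).card) := Nat.mul_le_mul_left 2 (ih (by omega))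
        _ = 2 ^ (k + 1) * (G 0).card := by ring
  have hPcard : 0 < P.card := Finset.card_pos.2 ⟨z, mem_block_self hL1 o _ z⟩
  have hG0pos : 0 < (G 0).card := by
    have h := hpow ℓ le_rfl
    rw [hGℓ] at h
    refine Nat.pos_of_ne_zero fun h0 => ?_
    rw [h0, mul_zero] at h
    omega
  -- the local sums
  set f : ℕ → Site d → ℝ := fun k u =>
    ∑ y ∈ block L o (n + k) u, (etaLaw J L o c α β (block L o (n + k) u)).real (openConn u y) with hf
  have hf0 : ∀ k u, 0 ≤ f k u := fun k u => Finset.sum_nonneg fun _ _ => measureReal_nonneg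
  have hT : ∀ k x, Tblock J L o c α β n (n + k) x = ∑ u ∈ block L o n x, f k u := by
    intro k x
    unfold Tblock
    refine Finset.sum_congr rfl fun u hu => ?_
    simp only [hf]
    rw [block_eq_block_of_mem_of_le hL1 ho hu (Nat.le_add_right n k)]
  have hfsum : ∀ k x, ∑ u ∈ block L o (n + k) x, f k u = sumConn J L o c α β (block L o (n + k) x) := by
    intro k x
    unfold sumConn
    refine Finset.sum_congr rfl fun u hu => ?_
    simp only [hf]
    rw [(block_eq_iff_mem hL1 o).2 hu]
  -- Claim B
  have hB : ∀ k, k ≤ ℓ → ∑ u ∈ G k, f k u ≤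
      ((G k).card : ℝ) / (((L ^ (n + k)) ^ d : ℕ) : ℝ) * Φ (n + k) := by
    intro k hk
    rw [sum_eq_sum_image_block hL1 (hGsat k hk) (f k)]
    have hcard := card_eq_card_image_block_mul hL1 (hGsat k hk)
    have hle : ∀ B' ∈ (G k).image (block L o (n + k)), ∑ u ∈ B', f k u ≤ Φ (n + k) := by
      intro B' hB'
      obtain ⟨x, hx, rfl⟩ := Finset.mem_image.1 hB'
      rw [hfsum]
      exact hΦ (n + k) x (Finset.mem_filter.1 hx).2
    have hpos : (0 : ℝ) < (((L ^ (n + k)) ^ d : ℕ) : ℝ) := by positivity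
    calc ∑ B' ∈ (G k).image (block L o (n + k)), ∑ u ∈ B', f k u
        ≤ ∑ _B' ∈ (G k).image (block L o (n + k)), Φ (n + k) := Finset.sum_le_sum hle
      _ = ((G k).image (block L o (n + k))).card * Φ (n + k) := by rw [Finset.sum_const, nsmul_eq_mul]
      _ = ((G k).card : ℝ) / (((L ^ (n + k)) ^ d : ℕ) : ℝ) * Φ (n + k) := by
          rw [hcard]; push_cast; field_simp
  -- the `n`-blocks of `G 0`
  set 𝓑₀ := (G 0).image (block L o n) with h𝓑₀
  have hsat0 : ∀ x ∈ G 0, block L o n x ⊆ G 0 := hGsat 0 (Nat.zero_le _)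
  have hcard0 : (G 0).card = 𝓑₀.card * (L ^ n) ^ d := card_eq_card_image_block_mul hL1 hsat0
  have h𝓑₀pos : (0 : ℝ) < 𝓑₀.card := by
    have : 0 < 𝓑₀.card := by
      refine Nat.pos_of_ne_zero fun h0 => ?_
      rw [h0, zero_mul] at hcard0
      omega
    exact_mod_cast this
  set T : ℕ → Finset (Site d) → ℝ := fun k B => ∑ u ∈ B, f k u with hTdef
  have hT0 : ∀ k B, 0 ≤ T k B := fun k B => Finset.sum_nonneg fun u _ => hf0 k u
  set bound : ℕ → ℝ := fun k => 4 ^ k * ((L : ℝ) ^ (d * k))⁻¹ * Φ (n + k) with hbound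
  have hbound0 : ∀ k, 0 ≤ bound k := fun k =>
    mul_nonneg (mul_nonneg (pow_nonneg (by norm_num) k) (inv_nonneg.2 (pow_nonneg hℓ0.le _))) (hΦ0 _)
  -- Markov for each `1 ≤ k ≤ ℓ`
  have hsumT : ∀ k, k ≤ ℓ → ∑ B ∈ 𝓑₀, T k B ≤ (1 / 2 : ℝ) ^ k * 𝓑₀.card * bound k := by
    intro k hk
    have h1 : ∑ B ∈ 𝓑₀, T k B = ∑ u ∈ G 0, f k u := (sum_eq_sum_image_block hL1 hsat0 (f k)).symm
    have h2 : ∑ u ∈ G 0, f k u ≤ ∑ u ∈ G k, f k u :=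
      Finset.sum_le_sum_of_subset_of_nonneg (hG0k k) fun u _ _ => hf0 k u
    have h3 := hB k hk
    have h4 : ((G k).card : ℝ) ≤ 2 ^ k * (G 0).card := by exact_mod_cast hpow k hk
    have hpos : (0 : ℝ) < (((L ^ (n + k)) ^ d : ℕ) : ℝ) := by positivity
    have hLnk : (((L ^ (n + k)) ^ d : ℕ) : ℝ) = ((L ^ n) ^ d : ℕ) * (L : ℝ) ^ (d * k) := by
      push_cast
      rw [← pow_mul, ← pow_mul, ← pow_add]
      congr 1; ring
    rw [h1]
    refine h2.trans (h3.trans ?_)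
    calc ((G k).card : ℝ) / (((L ^ (n + k)) ^ d : ℕ) : ℝ) * Φ (n + k)
        ≤ 2 ^ k * (G 0).card / (((L ^ (n + k)) ^ d : ℕ) : ℝ) * Φ (n + k) := by
          apply mul_le_mul_of_nonneg_right _ (hΦ0 _)
          exact div_le_div_of_nonneg_right h4 hpos.le
      _ = (1 / 2 : ℝ) ^ k * 𝓑₀.card * bound k := by
          simp only [hbound]
          rw [hcard0, hLnk, show (4 : ℝ) ^ k = 2 ^ k * 2 ^ k by rw [← mul_pow]; norm_num,
            one_div, inv_pow]
          have hLdk : (L : ℝ) ^ (d * k) ≠ 0 := by positivity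
          have hLn : ((L : ℝ) ^ n) ^ d ≠ 0 := by positivity
          have h2k : (2 : ℝ) ^ k ≠ 0 := pow_ne_zero _ two_ne_zero
          push_cast
          field_simp
  have hD : ∀ k, k ≤ ℓ → ((𝓑₀.filter fun B => bound k < T k B).card : ℝ) ≤ (1 / 2 : ℝ) ^ k * 𝓑₀.card := by
    intro k hk
    have hM := card_filter_lt_mul_le_sum 𝓑₀ (T k) (fun B _ => hT0 k B) (bound k)
    have h := hM.trans (hsumT k hk)
    rcases (hbound0 k).lt_or_eq with hbpos | hb0
    · -- divide by `bound k > 0`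
      have := div_le_div_of_nonneg_right h hbpos.le
      rwa [mul_div_cancel_left₀ _ hbpos.ne', mul_div_cancel_right₀ _ hbpos.ne'] at this
    · -- `bound k = 0`: all `T k B = 0`, the filter is empty
      have hall : ∀ B ∈ 𝓑₀, T k B = 0 := by
        have hs : ∑ B ∈ 𝓑₀, T k B ≤ 0 := by
          have := hsumT k hk; rw [← hb0, mul_zero] at this; exact this
        have hs0 : ∑ B ∈ 𝓑₀, T k B = 0 := le_antisymm hs (Finset.sum_nonneg fun B _ => hT0 k B)
        exact (Finset.sum_eq_zero_iff_of_nonneg fun B _ => hT0 k B).1 hs0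
      have hempty : (𝓑₀.filter fun B => bound k < T k B) = ∅ := by
        refine Finset.filter_eq_empty_iff.2 fun B hB => ?_
        rw [hall B hB, ← hb0]; exact lt_irrefl 0
      rw [hempty, Finset.card_empty, Nat.cast_zero]
      positivity
  -- pick a block outside all the `𝒟_k`, `1 ≤ k ≤ ℓ`
  have hex : ∃ B ∈ 𝓑₀, ∀ k ∈ Finset.Icc 1 ℓ, ¬ (bound k < T k B) := by
    by_contra hcon
    push Not at hcon
    have hsub : 𝓑₀ ⊆ (Finset.Icc 1 ℓ).biUnion fun k => 𝓑₀.filter fun B => bound k < T k B := by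
      intro B hB
      obtain ⟨k, hk, hlt⟩ := hcon B hB
      exact Finset.mem_biUnion.2 ⟨k, hk, Finset.mem_filter.2 ⟨hB, hlt⟩⟩
    have h1 := Finset.card_le_card hsub
    have h2 := Finset.card_biUnion_le (s := Finset.Icc 1 ℓ) (t := fun k => 𝓑₀.filter fun B => bound k < T k B)
    have h3 : ((𝓑₀.card : ℕ) : ℝ) ≤ ∑ k ∈ Finset.Icc 1 ℓ, ((𝓑₀.filter fun B => bound k < T k B).card : ℝ) := by
      exact_mod_cast h1.trans h2
    have h4 : ∑ k ∈ Finset.Icc 1 ℓ, ((𝓑₀.filter fun B => bound k < T k B).card : ℝ) ≤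
        (1 - (1 / 2 : ℝ) ^ ℓ) * 𝓑₀.card := by
      rw [← sum_Icc_half_pow, Finset.sum_mul]
      exact Finset.sum_le_sum fun k hk => hD k (Finset.mem_Icc.1 hk).2
    have h5 : (0 : ℝ) < (1 / 2 : ℝ) ^ ℓ := by positivity
    nlinarith
  obtain ⟨B, hB𝓑, hBk⟩ := hex
  obtain ⟨x, hx, rfl⟩ := Finset.mem_image.1 hB𝓑
  obtain ⟨hxP, hxg⟩ := Finset.mem_filter.1 hx
  refine ⟨x, hxP, by simpa using hxg, fun k hk => ?_⟩
  rw [hT]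
  rcases Nat.eq_zero_or_pos k with rfl | hkpos
  · -- `k = 0`: `𝐓_0 = Σ_{x,y ∈ B_n} … ≤ Φ n`
    have h1 : ∑ u ∈ block L o n x, f 0 u = sumConn J L o c α β (block L o (n + 0) x) := hfsum 0 x
    rw [h1]
    simpa using hΦ n x (by simpa using hxg)
  · have := hBk k (Finset.mem_Icc.2 ⟨hkpos, hk⟩)
    rw [not_lt] at this
    exact this

end ExcellentMain


end Literature.Probability.Percolation

end
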